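import Mathlib
import HarnessLib
import Summits.KontsevichZagierPeriods.KontsevichZagierPeriods.Theses.LinRedNormalForm
import Summits.KontsevichZagierPeriods.KontsevichZagierPeriods.Theorems.LinRedNormalFormArrangementNormalFormStubCompactify
import Summits.KontsevichZagierPeriods.KontsevichZagierPeriods.Theorems.LinRedNormalFormArrangementNormalFormStubWords
import Summits.KontsevichZagierPeriods.KontsevichZagierPeriods.Theorems.LinRedNormalFormArrangementNormalFormStubUnletter
import Summits.KontsevichZagierPeriods.KontsevichZagierPeriods.Theorems.LinRedNormalFormArrangementNormalFormStubReRead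
import Summits.KontsevichZagierPeriods.KontsevichZagierPeriods.Theorems.LinRedNormalFormArrangementNormalFormStubIntegrateOut
import Summits.KontsevichZagierPeriods.KontsevichZagierPeriods.Theorems.LinRedNormalFormArrangementNormalFormStubSeparateZero
import Summits.KontsevichZagierPeriods.KontsevichZagierPeriods.Theorems.LinRedNormalFormArrangementNormalFormStubRebaseOne
import Summits.KontsevichZagierPeriods.KontsevichZagierPeriods.Theorems.LinRedNormalFormArrangementNormalFormStubSeparateTwoZero
import Summits.KontsevichZagierPeriods.KontsevichZagierPeriods.Theorems.LinRedNormalFormArrangementNormalFormStubCompactifyZero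
import Summits.KontsevichZagierPeriods.KontsevichZagierPeriods.Theorems.LinRedNormalFormArrangementNormalFormStubIntegrateOutPrime
import Summits.KontsevichZagierPeriods.KontsevichZagierPeriods.Theorems.LinRedNormalFormArrangementNormalFormStubSeparateTwoPos
import Summits.KontsevichZagierPeriods.KontsevichZagierPeriods.Theorems.LinRedNormalFormArrangementNormalFormStubSeparateTwoPosHI
import Summits.KontsevichZagierPeriods.KontsevichZagierPeriods.Theorems.LinRedNormalFormArrangementNormalFormStubSeparateThreeZero
import Summits.KontsevichZagierPeriods.KontsevichZagierPeriods.Theorems.LinRedNormalFormArrangementNormalFormStubRebaseSimplePosOneZero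
import Summits.KontsevichZagierPeriods.KontsevichZagierPeriods.Theorems.LinRedNormalFormArrangementNormalFormSeparateThreeKAssembly
import Summits.KontsevichZagierPeriods.KontsevichZagierPeriods.Theorems.LinRedNormalFormArrangementNormalFormSeparateThreeHHKFinal
import Summits.KontsevichZagierPeriods.KontsevichZagierPeriods.Theorems.LinRedNormalFormArrangementNormalFormSeparateAllHHFinal
import Summits.KontsevichZagierPeriods.KontsevichZagierPeriods.Theorems.LinRedNormalFormArrangementNormalFormStubRebaseSimplePosOnePosHUFinal

/-!
# Line `janus-bands` — skeleton v14 for crux `ArrangementNormalForm` (stmt-KontsevichZagierPeriods-3915)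

Continuation lead c2 (2026-08-16). v7: `stub_separateTwoPos` (the planar assembly with fibres) LANDED
(p126547, c1 wave) and is imported. v8: the minimal cases gating the DIMENSION-3 corollary
`ArrangementNormalForm_dimLE3` are isolated as registered stubs — `stub_separateThreeZero` (JJ 3 0),
`stub_rebaseSimpleZeroTwo` (GS 0 2), `stub_rebaseSimplePosOne` (GS (b+1) 1), plus the analytic lemma
`stub_separateTwoPos_hI` — next to the general remainders `stub_separateHigh`,
`stub_rebaseSimpleZeroMany`, `stub_rebaseSimplePosMany` (7 stubs). v9: `stub_separateTwoPos_hI` LANDED (p129652, c2 wave 1: thin-sector cover + ray theorems) —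
planar separation with fibres is now unconditional; 6 stubs open. v10: `stub_rebaseSimplePosOne` split into
`…OneZero` (base dimension 2, needed in dimension 3) and `…OnePos` (7 stubs). v11: `stub_separateThreeZero`
LANDED (p140578, c2 wave 2: 3-d far-first engine `separateThreeZero_of_hI3` + rim-condition split lemma
`separateThree_hI`); `stub_rebaseSimpleZeroTwo` / `stub_rebaseSimplePosOneZero` re-registered with the NARROW target
`closure (GG b 2 k)` and without the `JJ/JD` binders (their proofs land in `GG`; the registry truncates signatures
at 4000 characters). `stub_rebaseSimplePosOneZero` LANDED (p140633, c2 wave 2: corner calculus + level splits);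
5 stubs open: `stub_separateHigh`, `stub_rebaseSimpleZeroTwo`, `stub_rebaseSimpleZeroMany`, `stub_rebaseSimplePosOnePos`,
`stub_rebaseSimplePosMany` — and `ArrangementNormalForm_dimLE3` now depends on `stub_rebaseSimpleZeroTwo` ONLY.
v12: `stub_separateHigh` REPLACED by the analytic family (W17, c2 wave 3: `separateHigh_of_hH` p144092 reduces
separation in every base dimension ≥ 3 with any number of fibres to the wall-invariant convergence lemmas):
`separateThree_hHk` (base dimension 3 with fibres) and `stub_separateHigh_hH B` (base dimension ≥ 4). 6 stubs.
v13: `separateThree_hHk` LANDED (p154574, c2 wave 3, W18b: nested thin sectors, 3-parameter fibre-mass weights) —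
SEPARATION IS UNCONDITIONAL IN BASE DIMENSION ≤ 3 WITH ANY NUMBER OF FIBRES. 5 stubs open: `stub_separateHigh_hH`
(base ≥ 4, pure analysis), `stub_rebaseSimpleZeroTwo` (two pole-at-pinch-vertex residues), `stub_rebaseSimpleZeroMany`,
`stub_rebaseSimplePosOnePos`, `stub_rebaseSimplePosMany`.
v14: `stub_separateHigh_hH` LANDED (p162191, W23, dimension-free nested sectors) — THE SEPARATION HALF OF THE CRUX IS
CLOSED IN EVERY DIMENSION; `rebaseSimplePosOnePos_two'` LANDED (p162093, W25: one-fibre rebase over a 3-dim base); the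
one-fibre stub is split into that case and `stub_rebaseSimplePosOneHigh` (base ≥ 4). 4 stubs open: `stub_rebaseSimpleZeroTwo`
(two pinch-vertex residues), `stub_rebaseSimpleZeroMany`, `stub_rebaseSimplePosOneHigh`, `stub_rebaseSimplePosMany`.


Continuation lead c1 (2026-08-16). History: v1 planner (5 stubs); v2–v5 lead -0 (ten stubs LANDED:
`stub_compactify` p75209, `stub_compactifyZero` p106267, `stub_words` p74868, `stub_unletter` p82432,
`stub_reRead` p84239, `stub_integrateOut` p94477, `stub_integrateOutLow` p76318, `stub_separateZero`
p94756, `stub_separateTwoZero` p119543, `stub_rebaseOne` p99133; planar corollary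
`ArrangementNormalForm_dimLE2` p119768; v5 open: `stub_separateTwoPos`, `stub_separateHigh`,
`stub_rebaseRest`).

## v6 change: the rebase bottleneck is cut down to the SIMPLE base pole

Lead -0's failure locus for `stub_rebaseRest` was "base pole of order `n₂ ≥ 2` + wall at the pinch
end" (braid-type letters forced from depth 3 WITH a higher base pole). But a separated
representation whose distinguished coordinate `y` carries `(y − ℓ₁)^{n₁}` or `(y − ℓ₂)^{-n₂}`,
`n₂ ≠ 1`, never needs rebasing: shear every lettered fibre along its own letter
(`tᵢ ↦ tᵢ − αᵢ y`, rule 2, affine, fibrewise), so that all letters are `y`-free and ALL the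
`y`-dependence sits in the (now arbitrary, still rational polyhedral) facets and in the `y`-factor;
promote the fibres to base coordinates, make `y` the innermost = last coordinate, dissect the flat
polytope by the order of the candidate `y`-bounds (rule 1a, null walls), and integrate `y` out by ONE
Newton–Leibniz move per piece with the RATIONAL primitive `(y − ℓ)^{n₁+1}/(n₁+1)` resp.
`(y − ℓ₂)^{1−n₂}/(1 − n₂)` — the output `[piece, (G(Y_hi) − G(Y_lo))·R]` is never split, so it is
absolutely convergent by Tonelli, and it is an arrangement representation of total dimension
`b + k` (`JJ (b+k) 0 ⊆ JD (b+k)`). This is `stub_integrateOutPrime` (class `GI b k` = `GG b 1 k`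
with `n₂ ≠ 1`): the landed `stub_integrateOut` minus its `σ = 2` format hypothesis, plus the shear;
its parts 3–4 (`integrateOut_flatPole`, `integrateOut_flatPoly`, abstract in the bound finsets)
are reused verbatim. What is left of rebase is the class `GS b k` (`n₂ = 1`, simple base pole):
`stub_rebaseSimpleZero` (`b = 0`, `k ≥ 2`; lead -0's "uniform recipe for a simple base pole",
drefute g2 §3 facet-adapted expansion + g3 §4–5 signed scissors / pinch blow-up; unit tests X, N₂)
and `stub_rebaseSimplePos` (`b ≥ 1`, `k ≥ 1`); `k = 0` is vacuous and `(b, k) = (0, 1)` is the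
landed `stub_rebaseOne`.

## Classes

* `wordGens` — word representations.  * `Jw` — lettered order cells.
* `J b` / `JJ b k` — Janus band reps (base `b`, `k` fibres).  * `JD N` — total dimension `N`.
* `GG b σ k` — separated (`σ = 1`) / rebased (`σ = 2`); `G₁ b k` / `Gᵢ b k` cover `GG b 2 k`;
  `GS b k` (`n₂ = 1`) / `GI b k` (`n₂ ≠ 1`) cover `GG b 1 k` (NEW in v6).

## Chain (✓ = landed)

compactify ✓ · separate: Zero ✓ / TwoZero ✓ / TwoPos / High · GI: integrateOutPrime ✓ (p122751, c1 wave 1) ·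
GS: rebase k = 0 (here) / rebaseOne ✓ / rebaseSimpleZero / rebaseSimplePos · GG b 2: reRead ✓ ·
integrateOut ✓ · unletter ✓ · words ✓; composition = lexicographic induction on (b + k, b).
-/

noncomputable section

set_option linter.dupNamespace false

open MeasureTheory Set

namespace Summit.KontsevichZagierPeriods.KontsevichZagierPeriods.Cruxes.ArrangementNormalForm.JanusBands

open Literature.NumberTheory.Transcendental

/-- The crux's generator set: hyperlogarithm word representations `[Δ_w, q·∏ (tᵢ − aᵢ)⁻¹]`. -/
def wordGens : Set KZ.FormalRep :=
  {y : KZ.FormalRep | ∃ (w : ℕ) (a : Fin w → ℚ) (q : ℚ) (s : KZ.IntegralRep w), s.domain = {t | (∀ i, 0 < t i) ∧ (∀ i, t i < 1) ∧ StrictAnti t} ∧ Set.EqOn s.integrand (fun t => (q : ℝ) * ∏ i, 1 / (t i - (a i : ℝ))) s.domain ∧ y = KZ.of s}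

/-- Lettered order cells (v2). -/
def Jw : Set KZ.FormalRep :=
  {w : KZ.FormalRep | ∃ (k : ℕ) (s : KZ.IntegralRep k) (q : ℚ) (a : Fin k → ℚ) (lo hi : Fin k → Fin k ⊕ ℚ), Bornology.IsBounded s.domain ∧ s.domain = {z | ∀ i, Sum.elim z (fun c => (c : ℝ)) (lo i) < z i ∧ z i < Sum.elim z (fun c => (c : ℝ)) (hi i)} ∧ EqOn s.integrand (fun z => (q : ℝ) * ∏ i, 1 / (z i - (a i : ℝ))) s.domain ∧ w = KZ.of s}

/-- Janus band representations with base dimension `b`, any number of fibres (v2 interface). -/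
def J : ℕ → Set KZ.FormalRep := fun b =>
  {w : KZ.FormalRep | ∃ (k m m' : ℕ) (s : KZ.IntegralRep (b + k)) (M : Fin m' → (Fin b → ℚ) × ℚ) (L : Fin m → (Fin b → ℚ) × ℚ) (e : Fin m → ℕ) (p : MvPolynomial (Fin b) ℚ) (a : Fin k → Option ((Fin b → ℚ) × ℚ)) (lo hi : Fin k → Fin k ⊕ ((Fin b → ℚ) × ℚ)), Bornology.IsBounded s.domain ∧ s.domain = {z | (∀ j, 0 < ∑ i, ((M j).1 i : ℝ) * z (Fin.castAdd k i) + ((M j).2 : ℝ)) ∧ ∀ i, Sum.elim (fun j => z (Fin.natAdd b j)) (fun c => ∑ i', (c.1 i' : ℝ) * z (Fin.castAdd k i') + (c.2 : ℝ)) (lo i) < z (Fin.natAdd b i) ∧ z (Fin.natAdd b i) < Sum.elim (fun j => z (Fin.natAdd b j)) (fun c => ∑ i', (c.1 i' : ℝ) * z (Fin.castAdd k i') + (c.2 : ℝ)) (hi i)} ∧ EqOn s.integrand (fun z => MvPolynomial.aeval (fun i => z (Fin.castAdd k i)) p / (∏ j, (∑ i, ((L j).1 i : ℝ) * z (Fin.castAdd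 k i) + ((L j).2 : ℝ)) ^ e j) * ∏ i, (a i).elim 1 (fun c => 1 / (z (Fin.natAdd b i) - (∑ i', (c.1 i' : ℝ) * z (Fin.castAdd k i') + (c.2 : ℝ))))) s.domain ∧ w = KZ.of s}

/-- Janus band representations with base dimension `b` and exactly `k` fibres. -/
def JJ : ℕ → ℕ → Set KZ.FormalRep := fun b k =>
  {w : KZ.FormalRep | ∃ (m m' : ℕ) (s : KZ.IntegralRep (b + k)) (M : Fin m' → (Fin b → ℚ) × ℚ) (L : Fin m → (Fin b → ℚ) × ℚ) (e : Fin m → ℕ) (p : MvPolynomial (Fin b) ℚ) (a : Fin k → Option ((Fin b → ℚ) × ℚ)) (lo hi : Fin k → Fin k ⊕ ((Fin b → ℚ) × ℚ)), Bornology.IsBounded s.domain ∧ s.domain = {z | (∀ j, 0 < ∑ i, ((M j).1 i : ℝ) * z (Fin.castAdd k i) + ((M j).2 : ℝ)) ∧ ∀ i, Sum.elim (fun j => z (Fin.natAdd b j)) (fun c => ∑ i', (c.1 i' : ℝ) * z (Fin.castAdd k i') + (c.2 : ℝ)) (lo i) < z (Fin.natAdd b i) ∧ z (Fin.natAdd b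 i) < Sum.elim (fun j => z (Fin.natAdd b j)) (fun c => ∑ i', (c.1 i' : ℝ) * z (Fin.castAdd k i') + (c.2 : ℝ)) (hi i)} ∧ EqOn s.integrand (fun z => MvPolynomial.aeval (fun i => z (Fin.castAdd k i)) p / (∏ j, (∑ i, ((L j).1 i : ℝ) * z (Fin.castAdd k i) + ((L j).2 : ℝ)) ^ e j) * ∏ i, (a i).elim 1 (fun c => 1 / (z (Fin.natAdd b i) - (∑ i', (c.1 i' : ℝ) * z (Fin.castAdd k i') + (c.2 : ℝ))))) s.domain ∧ w = KZ.of s}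

/-- Separated / rebased Janus band representations, base `b + 1`, `k` fibres. -/
def GG : ℕ → ℕ → ℕ → Set KZ.FormalRep := fun b σ k =>
  {w : KZ.FormalRep | ∃ (m m' n₁ n₂ : ℕ) (s : KZ.IntegralRep (b + 1 + k)) (M : Fin m' → (Fin (b + 1) → ℚ) × ℚ) (L : Fin m → (Fin b → ℚ) × ℚ) (e : Fin m → ℕ) (p : MvPolynomial (Fin b) ℚ) (ℓ₁ ℓ₂ : (Fin b → ℚ) × ℚ) (a : Fin k → Option ((Fin (b + 1) → ℚ) × ℚ)) (lo hi : Fin k → Fin k ⊕ ((Fin (b + 1) → ℚ) × ℚ)), (n₁ = 0 ∨ n₂ = 0) ∧ (σ = 2 → (∀ i c, a i = some c → c.1 (Fin.last b) = 0) ∧ (∀ i c, (lo i = Sum.inr c ∨ hi i = Sum.inr c) → (c.1 (Fin.last b) = 0 ∨ c = (Pi.single (Fin.last b) 1, 0)))) ∧ Bornology.IsBounded s.domain ∧ s.domain = {z | (∀ j, 0 < ∑ i, ((M j).1 i : ℝ) * z (Fin.castAdd k i) + ((M j).2 : ℝ)) ∧ ∀ i, Sum.elim (fun j => z (Fin.natAdd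 (b + 1) j)) (fun c => ∑ i', (c.1 i' : ℝ) * z (Fin.castAdd k i') + (c.2 : ℝ)) (lo i) < z (Fin.natAdd (b + 1) i) ∧ z (Fin.natAdd (b + 1) i) < Sum.elim (fun j => z (Fin.natAdd (b + 1) j)) (fun c => ∑ i', (c.1 i' : ℝ) * z (Fin.castAdd k i') + (c.2 : ℝ)) (hi i)} ∧ EqOn s.integrand (fun z => MvPolynomial.aeval (fun i => z (Fin.castAdd k (Fin.castSucc i))) p / (∏ j, (∑ i, ((L j).1 i : ℝ) * z (Fin.castAdd k (Fin.castSucc i)) + ((L j).2 : ℝ)) ^ e j) * ((z (Fin.castAdd k (Fin.last b)) - (∑ i, (ℓ₁.1 i : ℝ) * z (Fin.castAdd k (Fin.castSucc i)) + (ℓ₁.2 : ℝ))) ^ n₁ / (z (Fin.castAdd k (Fin.last b)) - (∑ i, (ℓ₂.1 i : ℝ) * z (Fin.castAdd k (Fin.castSucc i)) + (ℓ₂.2 : ℝ))) ^ n₂) * ∏ i, (a i).elim 1 (fun c => 1 / (z (Fin.natAdd (b + 1) i) - (∑ i', (c.1 i' : ℝ) * z (Fin.castAdd k i') + (c.2 :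 ℝ))))) s.domain ∧ w = KZ.of s}

/-- `GG b 2 k` with a simple pole in the distinguished coordinate (`n₂ = 1`). -/
def G₁ : ℕ → ℕ → Set KZ.FormalRep := fun b k =>
  {w : KZ.FormalRep | ∃ (m m' n₁ n₂ : ℕ) (s : KZ.IntegralRep (b + 1 + k)) (M : Fin m' → (Fin (b + 1) → ℚ) × ℚ) (L : Fin m → (Fin b → ℚ) × ℚ) (e : Fin m → ℕ) (p : MvPolynomial (Fin b) ℚ) (ℓ₁ ℓ₂ : (Fin b → ℚ) × ℚ) (a : Fin k → Option ((Fin (b + 1) → ℚ) × ℚ)) (lo hi : Fin k → Fin k ⊕ ((Fin (b + 1) → ℚ) × ℚ)), (n₁ = 0 ∨ n₂ = 0) ∧ n₂ = 1 ∧ (∀ i c, a i = some c → c.1 (Fin.last b) = 0) ∧ (∀ i c, (lo i = Sum.inr c ∨ hi i = Sum.inr c) → (c.1 (Fin.last b) = 0 ∨ c = (Pi.single (Fin.last b) 1, 0))) ∧ Bornology.IsBounded s.domain ∧ s.domain = {z | (∀ j, 0 < ∑ i, ((M j).1 i : ℝ) * z (Fin.castAdd k i) + ((M j).2 : ℝ))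 ∧ ∀ i, Sum.elim (fun j => z (Fin.natAdd (b + 1) j)) (fun c => ∑ i', (c.1 i' : ℝ) * z (Fin.castAdd k i') + (c.2 : ℝ)) (lo i) < z (Fin.natAdd (b + 1) i) ∧ z (Fin.natAdd (b + 1) i) < Sum.elim (fun j => z (Fin.natAdd (b + 1) j)) (fun c => ∑ i', (c.1 i' : ℝ) * z (Fin.castAdd k i') + (c.2 : ℝ)) (hi i)} ∧ EqOn s.integrand (fun z => MvPolynomial.aeval (fun i => z (Fin.castAdd k (Fin.castSucc i))) p / (∏ j, (∑ i, ((L j).1 i : ℝ) * z (Fin.castAdd k (Fin.castSucc i)) + ((L j).2 : ℝ)) ^ e j) * ((z (Fin.castAdd k (Fin.last b)) - (∑ i, (ℓ₁.1 i : ℝ) * z (Fin.castAdd k (Fin.castSucc i)) + (ℓ₁.2 : ℝ))) ^ n₁ / (z (Fin.castAdd k (Fin.last b)) - (∑ i, (ℓ₂.1 i : ℝ) * z (Fin.castAdd k (Fin.castSucc i)) + (ℓ₂.2 : ℝ))) ^ n₂) * ∏ i, (a i).elim 1 (fun c => 1 / (z (Fin.natAdd (b + 1) i) - (∑ i', (c.1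 i' : ℝ) * z (Fin.castAdd k i') + (c.2 : ℝ))))) s.domain ∧ w = KZ.of s}

/-- `GG b 2 k` with `n₂ ≠ 1`: the distinguished coordinate can be integrated out. -/
def Gᵢ : ℕ → ℕ → Set KZ.FormalRep := fun b k =>
  {w : KZ.FormalRep | ∃ (m m' n₁ n₂ : ℕ) (s : KZ.IntegralRep (b + 1 + k)) (M : Fin m' → (Fin (b + 1) → ℚ) × ℚ) (L : Fin m → (Fin b → ℚ) × ℚ) (e : Fin m → ℕ) (p : MvPolynomial (Fin b) ℚ) (ℓ₁ ℓ₂ : (Fin b → ℚ) × ℚ) (a : Fin k → Option ((Fin (b + 1) → ℚ) × ℚ)) (lo hi : Fin k → Fin k ⊕ ((Fin (b + 1) → ℚ) × ℚ)), (n₁ = 0 ∨ n₂ = 0) ∧ n₂ ≠ 1 ∧ (∀ i c, a i = some c → c.1 (Fin.last b) = 0) ∧ (∀ i c, (lo i = Sum.inr c ∨ hi i = Sum.inr c) → (c.1 (Fin.last b) = 0 ∨ c = (Pi.single (Fin.last b) 1, 0))) ∧ Bornology.IsBounded s.domain ∧ s.domain = {z | (∀ j, 0 < ∑ i, ((M j).1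 i : ℝ) * z (Fin.castAdd k i) + ((M j).2 : ℝ)) ∧ ∀ i, Sum.elim (fun j => z (Fin.natAdd (b + 1) j)) (fun c => ∑ i', (c.1 i' : ℝ) * z (Fin.castAdd k i') + (c.2 : ℝ)) (lo i) < z (Fin.natAdd (b + 1) i) ∧ z (Fin.natAdd (b + 1) i) < Sum.elim (fun j => z (Fin.natAdd (b + 1) j)) (fun c => ∑ i', (c.1 i' : ℝ) * z (Fin.castAdd k i') + (c.2 : ℝ)) (hi i)} ∧ EqOn s.integrand (fun z => MvPolynomial.aeval (fun i => z (Fin.castAdd k (Fin.castSucc i))) p / (∏ j, (∑ i, ((L j).1 i : ℝ) * z (Fin.castAdd k (Fin.castSucc i)) + ((L j).2 : ℝ)) ^ e j) * ((z (Fin.castAdd k (Fin.last b)) - (∑ i, (ℓ₁.1 i : ℝ) * z (Fin.castAdd k (Fin.castSucc i)) + (ℓ₁.2 : ℝ))) ^ n₁ / (z (Fin.castAdd k (Fin.last b)) - (∑ i, (ℓ₂.1 i : ℝ) * z (Fin.castAdd k (Fin.castSucc i)) + (ℓ₂.2 : ℝ))) ^ n₂) * ∏ i, (a i).elim 1 (fun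 c => 1 / (z (Fin.natAdd (b + 1) i) - (∑ i', (c.1 i' : ℝ) * z (Fin.castAdd k i') + (c.2 : ℝ))))) s.domain ∧ w = KZ.of s}

/-- Janus band representations of total dimension `N`. -/
def JD : ℕ → Set KZ.FormalRep := fun N =>
  {w : KZ.FormalRep | ∃ b' k', b' + k' = N ∧ w ∈ JJ b' k'}


/-- `GG b 1 k` with a SIMPLE pole in the distinguished coordinate (`n₂ = 1`): the only separated
representations that still have to be rebased (v6). -/
def GS : ℕ → ℕ → Set KZ.FormalRep := fun b k =>
  {w : KZ.FormalRep | ∃ (m m' n₁ n₂ : ℕ) (s : KZ.IntegralRep (b + 1 + k)) (M : Fin m' → (Fin (b + 1) → ℚ) × ℚ) (L : Fin m → (Fin b → ℚ) × ℚ) (e : Fin m → ℕ) (p : MvPolynomial (Fin b) ℚ) (ℓ₁ ℓ₂ : (Fin b → ℚ) × ℚ) (a : Fin k → Option ((Fin (b + 1) → ℚ) × ℚ)) (lo hi : Fin k → Fin k ⊕ ((Fin (b + 1) → ℚ) × ℚ)), (n₁ = 0 ∨ n₂ = 0) ∧ n₂ = 1 ∧ Bornology.IsBounded s.domain ∧ s.domain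 = {z | (∀ j, 0 < ∑ i, ((M j).1 i : ℝ) * z (Fin.castAdd k i) + ((M j).2 : ℝ)) ∧ ∀ i, Sum.elim (fun j => z (Fin.natAdd (b + 1) j)) (fun c => ∑ i', (c.1 i' : ℝ) * z (Fin.castAdd k i') + (c.2 : ℝ)) (lo i) < z (Fin.natAdd (b + 1) i) ∧ z (Fin.natAdd (b + 1) i) < Sum.elim (fun j => z (Fin.natAdd (b + 1) j)) (fun c => ∑ i', (c.1 i' : ℝ) * z (Fin.castAdd k i') + (c.2 : ℝ)) (hi i)} ∧ EqOn s.integrand (fun z => MvPolynomial.aeval (fun i => z (Fin.castAdd k (Fin.castSucc i))) p / (∏ j, (∑ i, ((L j).1 i : ℝ) * z (Fin.castAdd k (Fin.castSucc i)) + ((L j).2 : ℝ)) ^ e j) * ((z (Fin.castAdd k (Fin.last b)) - (∑ i, (ℓ₁.1 i : ℝ) * z (Fin.castAdd k (Fin.castSucc i)) + (ℓ₁.2 : ℝ))) ^ n₁ / (z (Fin.castAdd k (Fin.last b)) - (∑ i, (ℓ₂.1 i : ℝ) * z (Fin.castAdd k (Fin.castSucc i)) + (ℓ₂.2 : ℝ)))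 ^ n₂) * ∏ i, (a i).elim 1 (fun c => 1 / (z (Fin.natAdd (b + 1) i) - (∑ i', (c.1 i' : ℝ) * z (Fin.castAdd k i') + (c.2 : ℝ))))) s.domain ∧ w = KZ.of s}

/-- `GG b 1 k` with `n₂ ≠ 1`: the distinguished coordinate is integrated out directly
(`stub_integrateOutPrime`, v6), no rebase. -/
def GI : ℕ → ℕ → Set KZ.FormalRep := fun b k =>
  {w : KZ.FormalRep | ∃ (m m' n₁ n₂ : ℕ) (s : KZ.IntegralRep (b + 1 + k)) (M : Fin m' → (Fin (b + 1) → ℚ) × ℚ) (L : Fin m → (Fin b → ℚ) × ℚ) (e : Fin m → ℕ) (p : MvPolynomial (Fin b) ℚ) (ℓ₁ ℓ₂ : (Fin b → ℚ) × ℚ) (a : Fin k → Option ((Fin (b + 1) → ℚ) × ℚ)) (lo hi : Fin k → Fin k ⊕ ((Fin (b + 1) → ℚ) × ℚ)), (n₁ = 0 ∨ n₂ = 0) ∧ n₂ ≠ 1 ∧ Bornology.IsBounded s.domain ∧ s.domain = {z | (∀ j, 0 < ∑ i, ((M j).1 i : ℝ) * z (Fin.castAdd k i) + ((M j).2 : ℝ))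 ∧ ∀ i, Sum.elim (fun j => z (Fin.natAdd (b + 1) j)) (fun c => ∑ i', (c.1 i' : ℝ) * z (Fin.castAdd k i') + (c.2 : ℝ)) (lo i) < z (Fin.natAdd (b + 1) i) ∧ z (Fin.natAdd (b + 1) i) < Sum.elim (fun j => z (Fin.natAdd (b + 1) j)) (fun c => ∑ i', (c.1 i' : ℝ) * z (Fin.castAdd k i') + (c.2 : ℝ)) (hi i)} ∧ EqOn s.integrand (fun z => MvPolynomial.aeval (fun i => z (Fin.castAdd k (Fin.castSucc i))) p / (∏ j, (∑ i, ((L j).1 i : ℝ) * z (Fin.castAdd k (Fin.castSucc i)) + ((L j).2 : ℝ)) ^ e j) * ((z (Fin.castAdd k (Fin.last b)) - (∑ i, (ℓ₁.1 i : ℝ) * z (Fin.castAdd k (Fin.castSucc i)) + (ℓ₁.2 : ℝ))) ^ n₁ / (z (Fin.castAdd k (Fin.last b)) - (∑ i, (ℓ₂.1 i : ℝ) * z (Fin.castAdd k (Fin.castSucc i)) + (ℓ₂.2 : ℝ))) ^ n₂) * ∏ i, (a i).elim 1 (fun c => 1 / (z (Fin.natAdd (b + 1) i) - (∑ i', (c.1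 i' : ℝ) * z (Fin.castAdd k i') + (c.2 : ℝ))))) s.domain ∧ w = KZ.of s}

/-! ## Open stubs (registered) -/







/-- **stub_rebaseSimpleZeroTwo** (L+, v8 split of `stub_rebaseSimpleZero`; the case the dimension-3
corollary needs). Rebase over a ONE-dimensional base with a SIMPLE base pole and exactly TWO fibres:
`GS 0 2 → closure (GG 0 2 2)`. Product fibres: fibre-by-fibre Janus template of `stub_rebaseOne` with
spectators (`RebaseZero.*`, parts ProductTools/Basic/Moves/Wedge/Blow/Above landed). Nested fibres
`tᵢ < tⱼ`: letter-parallel sections (`RebaseNest.nestSection`), signed sub-section Janus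
(`RebaseNest.subJanus`), cone estimate at pinch vertices (`RebaseNest.pinchAbove`), pinch blow-up
`(Y, T) ↦ (T_k, T/Y)` (`RebaseNest.blow_*`, drefute g3 §5), rule (1b) edge-direction expansion for
letters of different `y`-slope (drefute g2 §3). Unit tests: X, X′, N₂, B. -/
theorem stub_rebaseSimpleZeroTwo (GS : ℕ → ℕ → Set KZ.FormalRep) (GG : ℕ → ℕ → ℕ → Set KZ.FormalRep) (hGS : ∀ b k, GS b k = {w : KZ.FormalRep | ∃ (m m' n₁ n₂ : ℕ) (s : KZ.IntegralRep (b + 1 + k)) (M : Fin m' → (Fin (b + 1) → ℚ) × ℚ) (L : Fin m → (Fin b → ℚ) × ℚ) (e : Fin m → ℕ) (p : MvPolynomial (Fin b) ℚ) (ℓ₁ ℓ₂ : (Fin b → ℚ) × ℚ) (a : Fin k → Option ((Fin (b + 1) → ℚ) × ℚ)) (lo hi : Fin k → Fin k ⊕ ((Fin (b + 1) → ℚ) × ℚ)), (n₁ = 0 ∨ n₂ = 0) ∧ n₂ = 1 ∧ Bornology.IsBounded s.domain ∧ s.domain = {z | (∀ j, 0 < ∑ i, ((M j).1 i : ℝ)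 * z (Fin.castAdd k i) + ((M j).2 : ℝ)) ∧ ∀ i, Sum.elim (fun j => z (Fin.natAdd (b + 1) j)) (fun c => ∑ i', (c.1 i' : ℝ) * z (Fin.castAdd k i') + (c.2 : ℝ)) (lo i) < z (Fin.natAdd (b + 1) i) ∧ z (Fin.natAdd (b + 1) i) < Sum.elim (fun j => z (Fin.natAdd (b + 1) j)) (fun c => ∑ i', (c.1 i' : ℝ) * z (Fin.castAdd k i') + (c.2 : ℝ)) (hi i)} ∧ EqOn s.integrand (fun z => MvPolynomial.aeval (fun i => z (Fin.castAdd k (Fin.castSucc i))) p / (∏ j, (∑ i, ((L j).1 i : ℝ) * z (Fin.castAdd k (Fin.castSucc i)) + ((L j).2 : ℝ)) ^ e j) * ((z (Fin.castAdd k (Fin.last b)) - (∑ i, (ℓ₁.1 i : ℝ) * z (Fin.castAdd k (Fin.castSucc i)) + (ℓ₁.2 : ℝ))) ^ n₁ / (z (Fin.castAdd k (Fin.last b)) - (∑ i, (ℓ₂.1 i : ℝ) * z (Fin.castAdd k (Fin.castSucc i)) + (ℓ₂.2 : ℝ))) ^ n₂) * ∏ i, (a i).elim 1 (fun c => 1 /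 (z (Fin.natAdd (b + 1) i) - (∑ i', (c.1 i' : ℝ) * z (Fin.castAdd k i') + (c.2 : ℝ))))) s.domain ∧ w = KZ.of s}) (hGG : ∀ b σ k, GG b σ k = {w : KZ.FormalRep | ∃ (m m' n₁ n₂ : ℕ) (s : KZ.IntegralRep (b + 1 + k)) (M : Fin m' → (Fin (b + 1) → ℚ) × ℚ) (L : Fin m → (Fin b → ℚ) × ℚ) (e : Fin m → ℕ) (p : MvPolynomial (Fin b) ℚ) (ℓ₁ ℓ₂ : (Fin b → ℚ) × ℚ) (a : Fin k → Option ((Fin (b + 1) → ℚ) × ℚ)) (lo hi : Fin k → Fin k ⊕ ((Fin (b + 1) → ℚ) × ℚ)), (n₁ = 0 ∨ n₂ = 0) ∧ (σ = 2 → (∀ i c, a i = some c → c.1 (Fin.last b) = 0) ∧ (∀ i c, (lo i = Sum.inr c ∨ hi i = Sum.inr c) → (c.1 (Fin.last b) = 0 ∨ c = (Pi.single (Fin.last b) 1, 0)))) ∧ Bornology.IsBounded s.domain ∧ s.domain = {z | (∀ j, 0 < ∑ i, ((M j).1 i : ℝ) * z (Fin.castAdd k i) + ((M j).2 : ℝ))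 ∧ ∀ i, Sum.elim (fun j => z (Fin.natAdd (b + 1) j)) (fun c => ∑ i', (c.1 i' : ℝ) * z (Fin.castAdd k i') + (c.2 : ℝ)) (lo i) < z (Fin.natAdd (b + 1) i) ∧ z (Fin.natAdd (b + 1) i) < Sum.elim (fun j => z (Fin.natAdd (b + 1) j)) (fun c => ∑ i', (c.1 i' : ℝ) * z (Fin.castAdd k i') + (c.2 : ℝ)) (hi i)} ∧ EqOn s.integrand (fun z => MvPolynomial.aeval (fun i => z (Fin.castAdd k (Fin.castSucc i))) p / (∏ j, (∑ i, ((L j).1 i : ℝ) * z (Fin.castAdd k (Fin.castSucc i)) + ((L j).2 : ℝ)) ^ e j) * ((z (Fin.castAdd k (Fin.last b)) - (∑ i, (ℓ₁.1 i : ℝ) * z (Fin.castAdd k (Fin.castSucc i)) + (ℓ₁.2 : ℝ))) ^ n₁ / (z (Fin.castAdd k (Fin.last b)) - (∑ i, (ℓ₂.1 i : ℝ) * z (Fin.castAdd k (Fin.castSucc i)) + (ℓ₂.2 : ℝ))) ^ n₂) * ∏ i, (a i).elim 1 (fun c => 1 / (z (Fin.natAdd (b + 1) i) - (∑ i', (c.1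 i' : ℝ) * z (Fin.castAdd k i') + (c.2 : ℝ))))) s.domain ∧ w = KZ.of s}) : ∀ x ∈ GS 0 2, ∃ c ∈ AddSubgroup.closure (GG 0 2 2), x - c ∈ KZ.relations := by
  sorry

/-- **stub_rebaseSimpleZeroMany** (crux-sized; v8 split). The same with `k + 3 ≥ 3` fibres:
`GS 0 (k+3) → closure (GG 0 2 (k+3))`. Lead -0's analysis: from depth 3 on, chains of nested fibres with
letters of pairwise different `y`-slopes force braid-type letters `1/(tᵢ − tⱼ − c)` in every convergent
intermediate, i.e. representations outside the `J/G` tower; expected to need a class extension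
(hyperlogarithm fibres with letters affine in EARLIER fibres) rather than a proof inside the tower. -/
theorem stub_rebaseSimpleZeroMany (GS : ℕ → ℕ → Set KZ.FormalRep) (GG : ℕ → ℕ → ℕ → Set KZ.FormalRep) (hGS : ∀ b k, GS b k = {w : KZ.FormalRep | ∃ (m m' n₁ n₂ : ℕ) (s : KZ.IntegralRep (b + 1 + k)) (M : Fin m' → (Fin (b + 1) → ℚ) × ℚ) (L : Fin m → (Fin b → ℚ) × ℚ) (e : Fin m → ℕ) (p : MvPolynomial (Fin b) ℚ) (ℓ₁ ℓ₂ : (Fin b → ℚ) × ℚ) (a : Fin k → Option ((Fin (b + 1) → ℚ) × ℚ)) (lo hi : Fin k → Fin k ⊕ ((Fin (b + 1) → ℚ) × ℚ)), (n₁ = 0 ∨ n₂ = 0) ∧ n₂ = 1 ∧ Bornology.IsBounded s.domain ∧ s.domain = {z | (∀ j, 0 < ∑ i, ((M j).1 i : ℝ) * z (Fin.castAdd k i) + ((M j).2 : ℝ)) ∧ ∀ i, Sum.elim (fun j => z (Fin.natAdd (b + 1) j)) (fun c => ∑ i', (c.1 i' : ℝ) * z (Fin.castAdd k i') + (c.2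 : ℝ)) (lo i) < z (Fin.natAdd (b + 1) i) ∧ z (Fin.natAdd (b + 1) i) < Sum.elim (fun j => z (Fin.natAdd (b + 1) j)) (fun c => ∑ i', (c.1 i' : ℝ) * z (Fin.castAdd k i') + (c.2 : ℝ)) (hi i)} ∧ EqOn s.integrand (fun z => MvPolynomial.aeval (fun i => z (Fin.castAdd k (Fin.castSucc i))) p / (∏ j, (∑ i, ((L j).1 i : ℝ) * z (Fin.castAdd k (Fin.castSucc i)) + ((L j).2 : ℝ)) ^ e j) * ((z (Fin.castAdd k (Fin.last b)) - (∑ i, (ℓ₁.1 i : ℝ) * z (Fin.castAdd k (Fin.castSucc i)) + (ℓ₁.2 : ℝ))) ^ n₁ / (z (Fin.castAdd k (Fin.last b)) - (∑ i, (ℓ₂.1 i : ℝ) * z (Fin.castAdd k (Fin.castSucc i)) + (ℓ₂.2 : ℝ))) ^ n₂) * ∏ i, (a i).elim 1 (fun c => 1 / (z (Fin.natAdd (b + 1) i) - (∑ i', (c.1 i' : ℝ) * z (Fin.castAdd k i') + (c.2 : ℝ))))) s.domain ∧ w = KZ.of s}) (hGG : ∀ b σ k, GG b σ k = {w : KZ.FormalRep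 | ∃ (m m' n₁ n₂ : ℕ) (s : KZ.IntegralRep (b + 1 + k)) (M : Fin m' → (Fin (b + 1) → ℚ) × ℚ) (L : Fin m → (Fin b → ℚ) × ℚ) (e : Fin m → ℕ) (p : MvPolynomial (Fin b) ℚ) (ℓ₁ ℓ₂ : (Fin b → ℚ) × ℚ) (a : Fin k → Option ((Fin (b + 1) → ℚ) × ℚ)) (lo hi : Fin k → Fin k ⊕ ((Fin (b + 1) → ℚ) × ℚ)), (n₁ = 0 ∨ n₂ = 0) ∧ (σ = 2 → (∀ i c, a i = some c → c.1 (Fin.last b) = 0) ∧ (∀ i c, (lo i = Sum.inr c ∨ hi i = Sum.inr c) → (c.1 (Fin.last b) = 0 ∨ c = (Pi.single (Fin.last b) 1, 0)))) ∧ Bornology.IsBounded s.domain ∧ s.domain = {z | (∀ j, 0 < ∑ i, ((M j).1 i : ℝ) * z (Fin.castAdd k i) + ((M j).2 : ℝ)) ∧ ∀ i, Sum.elim (fun j => z (Fin.natAdd (b + 1) j)) (fun c => ∑ i', (c.1 i' : ℝ) * z (Fin.castAdd k i') + (c.2 : ℝ)) (lo i) < z (Fin.natAdd (b + 1) i) ∧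 z (Fin.natAdd (b + 1) i) < Sum.elim (fun j => z (Fin.natAdd (b + 1) j)) (fun c => ∑ i', (c.1 i' : ℝ) * z (Fin.castAdd k i') + (c.2 : ℝ)) (hi i)} ∧ EqOn s.integrand (fun z => MvPolynomial.aeval (fun i => z (Fin.castAdd k (Fin.castSucc i))) p / (∏ j, (∑ i, ((L j).1 i : ℝ) * z (Fin.castAdd k (Fin.castSucc i)) + ((L j).2 : ℝ)) ^ e j) * ((z (Fin.castAdd k (Fin.last b)) - (∑ i, (ℓ₁.1 i : ℝ) * z (Fin.castAdd k (Fin.castSucc i)) + (ℓ₁.2 : ℝ))) ^ n₁ / (z (Fin.castAdd k (Fin.last b)) - (∑ i, (ℓ₂.1 i : ℝ) * z (Fin.castAdd k (Fin.castSucc i)) + (ℓ₂.2 : ℝ))) ^ n₂) * ∏ i, (a i).elim 1 (fun c => 1 / (z (Fin.natAdd (b + 1) i) - (∑ i', (c.1 i' : ℝ) * z (Fin.castAdd k i') + (c.2 : ℝ))))) s.domain ∧ w = KZ.of s}) (JJ : ℕ → ℕ → Set KZ.FormalRep) (JD : ℕ → Set KZ.FormalRep) (hJJ : ∀ b k, JJ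 b k = {w : KZ.FormalRep | ∃ (m m' : ℕ) (s : KZ.IntegralRep (b + k)) (M : Fin m' → (Fin b → ℚ) × ℚ) (L : Fin m → (Fin b → ℚ) × ℚ) (e : Fin m → ℕ) (p : MvPolynomial (Fin b) ℚ) (a : Fin k → Option ((Fin b → ℚ) × ℚ)) (lo hi : Fin k → Fin k ⊕ ((Fin b → ℚ) × ℚ)), Bornology.IsBounded s.domain ∧ s.domain = {z | (∀ j, 0 < ∑ i, ((M j).1 i : ℝ) * z (Fin.castAdd k i) + ((M j).2 : ℝ)) ∧ ∀ i, Sum.elim (fun j => z (Fin.natAdd b j)) (fun c => ∑ i', (c.1 i' : ℝ) * z (Fin.castAdd k i') + (c.2 : ℝ)) (lo i) < z (Fin.natAdd b i) ∧ z (Fin.natAdd b i) < Sum.elim (fun j => z (Fin.natAdd b j)) (fun c => ∑ i', (c.1 i' : ℝ) * z (Fin.castAdd k i') + (c.2 : ℝ)) (hi i)} ∧ EqOn s.integrand (fun z => MvPolynomial.aeval (fun i => z (Fin.castAdd k i)) p / (∏ j, (∑ i, ((L j).1 i : ℝ) * z (Fin.castAdd k i) + ((L j).2 : ℝ)) ^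 e j) * ∏ i, (a i).elim 1 (fun c => 1 / (z (Fin.natAdd b i) - (∑ i', (c.1 i' : ℝ) * z (Fin.castAdd k i') + (c.2 : ℝ))))) s.domain ∧ w = KZ.of s}) (hJD : ∀ N, JD N = {w : KZ.FormalRep | ∃ b' k', b' + k' = N ∧ w ∈ JJ b' k'}) (k : ℕ) : ∀ x ∈ GS 0 (k + 3), ∃ c ∈ AddSubgroup.closure (GG 0 2 (k + 3) ∪ JJ 0 (k + 4) ∪ JD (k + 3)), x - c ∈ KZ.relations := by
  sorry


/-- **stub_rebaseSimplePosOneHigh** (crux-sized; v14 split). One-fibre rebase over a base of dimension `b + 4 ≥ 4`: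
`GS (b+3) 1 → closure (GG (b+3) 2 1)` (narrow target, registry-safe statement). The base-dimension-3 case is LANDED
(`rebaseSimplePosOnePos_two'`, p162093: double corners from `Hpar` via the coaxial level; `Hpar` by flats isolation, the
quadruple-point corner calculus and RE-SELECTION of the distinguished coordinate through the landed separation theorems); for
`b + 4 ≥ 4` the flat loci `{h = w = 0}` and the triple loci are positive-dimensional affine subspaces of the silent base
(fibration over the flat locus; `rebaseSimplePosOnePos_of_HUQ'` p162006 reduces the wide-target statement to `(ε, HUQ)`). -/
theorem stub_rebaseSimplePosOneHigh (GS : ℕ → ℕ → Set KZ.FormalRep) (GG : ℕ → ℕ → ℕ → Set KZ.FormalRep) (hGS : ∀ b k, GS b k = {w : KZ.FormalRep | ∃ (m m' n₁ n₂ : ℕ) (s : KZ.IntegralRep (b + 1 + k)) (M : Fin m' → (Fin (b + 1) → ℚ) × ℚ) (L : Fin m → (Fin b → ℚ) × ℚ) (e : Fin m → ℕ) (p : MvPolynomial (Fin b) ℚ) (ℓ₁ ℓ₂ : (Fin b → ℚ) × ℚ) (a : Fin k → Option ((Fin (b + 1) → ℚ) × ℚ)) (lo hi : Fin k → Fin k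 ⊕ ((Fin (b + 1) → ℚ) × ℚ)), (n₁ = 0 ∨ n₂ = 0) ∧ n₂ = 1 ∧ Bornology.IsBounded s.domain ∧ s.domain = {z | (∀ j, 0 < ∑ i, ((M j).1 i : ℝ) * z (Fin.castAdd k i) + ((M j).2 : ℝ)) ∧ ∀ i, Sum.elim (fun j => z (Fin.natAdd (b + 1) j)) (fun c => ∑ i', (c.1 i' : ℝ) * z (Fin.castAdd k i') + (c.2 : ℝ)) (lo i) < z (Fin.natAdd (b + 1) i) ∧ z (Fin.natAdd (b + 1) i) < Sum.elim (fun j => z (Fin.natAdd (b + 1) j)) (fun c => ∑ i', (c.1 i' : ℝ) * z (Fin.castAdd k i') + (c.2 : ℝ)) (hi i)} ∧ EqOn s.integrand (fun z => MvPolynomial.aeval (fun i => z (Fin.castAdd k (Fin.castSucc i))) p / (∏ j, (∑ i, ((L j).1 i : ℝ) * z (Fin.castAdd k (Fin.castSucc i)) + ((L j).2 : ℝ)) ^ e j) * ((z (Fin.castAdd k (Fin.last b)) - (∑ i, (ℓ₁.1 i : ℝ) * z (Fin.castAdd k (Fin.castSucc i)) + (ℓ₁.2 : ℝ))) ^ n₁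 / (z (Fin.castAdd k (Fin.last b)) - (∑ i, (ℓ₂.1 i : ℝ) * z (Fin.castAdd k (Fin.castSucc i)) + (ℓ₂.2 : ℝ))) ^ n₂) * ∏ i, (a i).elim 1 (fun c => 1 / (z (Fin.natAdd (b + 1) i) - (∑ i', (c.1 i' : ℝ) * z (Fin.castAdd k i') + (c.2 : ℝ))))) s.domain ∧ w = KZ.of s}) (hGG : ∀ b σ k, GG b σ k = {w : KZ.FormalRep | ∃ (m m' n₁ n₂ : ℕ) (s : KZ.IntegralRep (b + 1 + k)) (M : Fin m' → (Fin (b + 1) → ℚ) × ℚ) (L : Fin m → (Fin b → ℚ) × ℚ) (e : Fin m → ℕ) (p : MvPolynomial (Fin b) ℚ) (ℓ₁ ℓ₂ : (Fin b → ℚ) × ℚ) (a : Fin k → Option ((Fin (b + 1) → ℚ) × ℚ)) (lo hi : Fin k → Fin k ⊕ ((Fin (b + 1) → ℚ) × ℚ)), (n₁ = 0 ∨ n₂ = 0) ∧ (σ = 2 → (∀ i c, a i = some c → c.1 (Fin.last b) = 0) ∧ (∀ i c, (lo i = Sum.inr c ∨ hi i = Sum.inr c) → (c.1 (Fin.last b)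 = 0 ∨ c = (Pi.single (Fin.last b) 1, 0)))) ∧ Bornology.IsBounded s.domain ∧ s.domain = {z | (∀ j, 0 < ∑ i, ((M j).1 i : ℝ) * z (Fin.castAdd k i) + ((M j).2 : ℝ)) ∧ ∀ i, Sum.elim (fun j => z (Fin.natAdd (b + 1) j)) (fun c => ∑ i', (c.1 i' : ℝ) * z (Fin.castAdd k i') + (c.2 : ℝ)) (lo i) < z (Fin.natAdd (b + 1) i) ∧ z (Fin.natAdd (b + 1) i) < Sum.elim (fun j => z (Fin.natAdd (b + 1) j)) (fun c => ∑ i', (c.1 i' : ℝ) * z (Fin.castAdd k i') + (c.2 : ℝ)) (hi i)} ∧ EqOn s.integrand (fun z => MvPolynomial.aeval (fun i => z (Fin.castAdd k (Fin.castSucc i))) p / (∏ j, (∑ i, ((L j).1 i : ℝ) * z (Fin.castAdd k (Fin.castSucc i)) + ((L j).2 : ℝ)) ^ e j) * ((z (Fin.castAdd k (Fin.last b)) - (∑ i, (ℓ₁.1 i : ℝ) * z (Fin.castAdd k (Fin.castSucc i)) + (ℓ₁.2 : ℝ))) ^ n₁ / (z (Fin.castAdd k (Fin.last b)) - (∑ i,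 (ℓ₂.1 i : ℝ) * z (Fin.castAdd k (Fin.castSucc i)) + (ℓ₂.2 : ℝ))) ^ n₂) * ∏ i, (a i).elim 1 (fun c => 1 / (z (Fin.natAdd (b + 1) i) - (∑ i', (c.1 i' : ℝ) * z (Fin.castAdd k i') + (c.2 : ℝ))))) s.domain ∧ w = KZ.of s}) (b : ℕ) : ∀ x ∈ GS (b + 3) 1, ∃ c ∈ AddSubgroup.closure (GG (b + 3) 2 1), x - c ∈ KZ.relations := by
  sorry

/-- **stub_rebaseSimplePosMany** (crux-sized; v8 split). The same with `k + 2 ≥ 2` fibres over a base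
of dimension `b + 2 ≥ 2`: `GS (b+1) (k+2) → closure (GG (b+1) 2 (k+2))`, uniformly in the silent base
coordinates after a rational dissection of the base cell by the walls where the `(y, t)`-combinatorics
degenerates; inherits both the `Many` obstruction of the one-dimensional base and `Hpar`. -/
theorem stub_rebaseSimplePosMany (GS : ℕ → ℕ → Set KZ.FormalRep) (GG : ℕ → ℕ → ℕ → Set KZ.FormalRep) (hGS : ∀ b k, GS b k = {w : KZ.FormalRep | ∃ (m m' n₁ n₂ : ℕ) (s : KZ.IntegralRep (b + 1 + k)) (M : Fin m' → (Fin (b + 1) → ℚ) × ℚ) (L : Fin m → (Fin b → ℚ) × ℚ) (e : Fin m → ℕ) (p : MvPolynomial (Fin b) ℚ) (ℓ₁ ℓ₂ : (Fin b → ℚ) × ℚ) (a : Fin k → Option ((Fin (b + 1) → ℚ) × ℚ)) (lo hi : Fin k → Fin k ⊕ ((Fin (b + 1) → ℚ) × ℚ)), (n₁ = 0 ∨ n₂ = 0) ∧ n₂ = 1 ∧ Bornology.IsBounded s.domain ∧ s.domain = {z | (∀ j, 0 < ∑ i, ((M j).1 i : ℝ) * z (Fin.castAdd k i) + ((M j).2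 : ℝ)) ∧ ∀ i, Sum.elim (fun j => z (Fin.natAdd (b + 1) j)) (fun c => ∑ i', (c.1 i' : ℝ) * z (Fin.castAdd k i') + (c.2 : ℝ)) (lo i) < z (Fin.natAdd (b + 1) i) ∧ z (Fin.natAdd (b + 1) i) < Sum.elim (fun j => z (Fin.natAdd (b + 1) j)) (fun c => ∑ i', (c.1 i' : ℝ) * z (Fin.castAdd k i') + (c.2 : ℝ)) (hi i)} ∧ EqOn s.integrand (fun z => MvPolynomial.aeval (fun i => z (Fin.castAdd k (Fin.castSucc i))) p / (∏ j, (∑ i, ((L j).1 i : ℝ) * z (Fin.castAdd k (Fin.castSucc i)) + ((L j).2 : ℝ)) ^ e j) * ((z (Fin.castAdd k (Fin.last b)) - (∑ i, (ℓ₁.1 i : ℝ) * z (Fin.castAdd k (Fin.castSucc i)) + (ℓ₁.2 : ℝ))) ^ n₁ / (z (Fin.castAdd k (Fin.last b)) - (∑ i, (ℓ₂.1 i : ℝ) * z (Fin.castAdd k (Fin.castSucc i)) + (ℓ₂.2 : ℝ))) ^ n₂) * ∏ i, (a i).elim 1 (fun c => 1 / (z (Fin.natAdd (b + 1) i) - (∑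 i', (c.1 i' : ℝ) * z (Fin.castAdd k i') + (c.2 : ℝ))))) s.domain ∧ w = KZ.of s}) (hGG : ∀ b σ k, GG b σ k = {w : KZ.FormalRep | ∃ (m m' n₁ n₂ : ℕ) (s : KZ.IntegralRep (b + 1 + k)) (M : Fin m' → (Fin (b + 1) → ℚ) × ℚ) (L : Fin m → (Fin b → ℚ) × ℚ) (e : Fin m → ℕ) (p : MvPolynomial (Fin b) ℚ) (ℓ₁ ℓ₂ : (Fin b → ℚ) × ℚ) (a : Fin k → Option ((Fin (b + 1) → ℚ) × ℚ)) (lo hi : Fin k → Fin k ⊕ ((Fin (b + 1) → ℚ) × ℚ)), (n₁ = 0 ∨ n₂ = 0) ∧ (σ = 2 → (∀ i c, a i = some c → c.1 (Fin.last b) = 0) ∧ (∀ i c, (lo i = Sum.inr c ∨ hi i = Sum.inr c) → (c.1 (Fin.last b) = 0 ∨ c = (Pi.single (Fin.last b) 1, 0)))) ∧ Bornology.IsBounded s.domain ∧ s.domain = {z | (∀ j, 0 < ∑ i, ((M j).1 i : ℝ) * z (Fin.castAdd k i) + ((M j).2 : ℝ)) ∧ ∀ i, Sum.elim (fun j =>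 z (Fin.natAdd (b + 1) j)) (fun c => ∑ i', (c.1 i' : ℝ) * z (Fin.castAdd k i') + (c.2 : ℝ)) (lo i) < z (Fin.natAdd (b + 1) i) ∧ z (Fin.natAdd (b + 1) i) < Sum.elim (fun j => z (Fin.natAdd (b + 1) j)) (fun c => ∑ i', (c.1 i' : ℝ) * z (Fin.castAdd k i') + (c.2 : ℝ)) (hi i)} ∧ EqOn s.integrand (fun z => MvPolynomial.aeval (fun i => z (Fin.castAdd k (Fin.castSucc i))) p / (∏ j, (∑ i, ((L j).1 i : ℝ) * z (Fin.castAdd k (Fin.castSucc i)) + ((L j).2 : ℝ)) ^ e j) * ((z (Fin.castAdd k (Fin.last b)) - (∑ i, (ℓ₁.1 i : ℝ) * z (Fin.castAdd k (Fin.castSucc i)) + (ℓ₁.2 : ℝ))) ^ n₁ / (z (Fin.castAdd k (Fin.last b)) - (∑ i, (ℓ₂.1 i : ℝ) * z (Fin.castAdd k (Fin.castSucc i)) + (ℓ₂.2 : ℝ))) ^ n₂) * ∏ i, (a i).elim 1 (fun c => 1 / (z (Fin.natAdd (b + 1) i) - (∑ i', (c.1 i' : ℝ) * z (Fin.castAdd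 k i') + (c.2 : ℝ))))) s.domain ∧ w = KZ.of s}) (JJ : ℕ → ℕ → Set KZ.FormalRep) (JD : ℕ → Set KZ.FormalRep) (hJJ : ∀ b k, JJ b k = {w : KZ.FormalRep | ∃ (m m' : ℕ) (s : KZ.IntegralRep (b + k)) (M : Fin m' → (Fin b → ℚ) × ℚ) (L : Fin m → (Fin b → ℚ) × ℚ) (e : Fin m → ℕ) (p : MvPolynomial (Fin b) ℚ) (a : Fin k → Option ((Fin b → ℚ) × ℚ)) (lo hi : Fin k → Fin k ⊕ ((Fin b → ℚ) × ℚ)), Bornology.IsBounded s.domain ∧ s.domain = {z | (∀ j, 0 < ∑ i, ((M j).1 i : ℝ) * z (Fin.castAdd k i) + ((M j).2 : ℝ)) ∧ ∀ i, Sum.elim (fun j => z (Fin.natAdd b j)) (fun c => ∑ i', (c.1 i' : ℝ) * z (Fin.castAdd k i') + (c.2 : ℝ)) (lo i) < z (Fin.natAdd b i) ∧ z (Fin.natAdd b i) < Sum.elim (fun j => z (Fin.natAdd b j)) (fun c => ∑ i', (c.1 i' : ℝ) * z (Fin.castAdd k i') + (c.2 : ℝ)) (hi i)} ∧ EqOn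 s.integrand (fun z => MvPolynomial.aeval (fun i => z (Fin.castAdd k i)) p / (∏ j, (∑ i, ((L j).1 i : ℝ) * z (Fin.castAdd k i) + ((L j).2 : ℝ)) ^ e j) * ∏ i, (a i).elim 1 (fun c => 1 / (z (Fin.natAdd b i) - (∑ i', (c.1 i' : ℝ) * z (Fin.castAdd k i') + (c.2 : ℝ))))) s.domain ∧ w = KZ.of s}) (hJD : ∀ N, JD N = {w : KZ.FormalRep | ∃ b' k', b' + k' = N ∧ w ∈ JJ b' k'}) (b k : ℕ) : ∀ x ∈ GS (b + 1) (k + 2), ∃ c ∈ AddSubgroup.closure (GG (b + 1) 2 (k + 2) ∪ JJ (b + 1) (k + 3) ∪ JD (b + k + 3)), x - c ∈ KZ.relations := by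
  sorry

/-! ## Composition (sorry-free): lexicographic induction on (total dimension, base dimension) -/

/-- Additive extension of a generator-wise congruence to the generated subgroup. -/
theorem closure_transfer {S T : Set KZ.FormalRep}
    (h : ∀ x ∈ S, ∃ c ∈ AddSubgroup.closure T, x - c ∈ KZ.relations) :
    ∀ x ∈ AddSubgroup.closure S, ∃ c ∈ AddSubgroup.closure T, x - c ∈ KZ.relations := by
  intro x hx
  induction hx using AddSubgroup.closure_induction with
  | mem x hx => exact h x hx
  | zero => exact ⟨0, zero_mem _, by simp⟩
  | add x y _ _ ihx ihy =>
    obtain ⟨m₁, hm₁, h₁⟩ := ihx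
    obtain ⟨m₂, hm₂, h₂⟩ := ihy
    refine ⟨m₁ + m₂, add_mem hm₁ hm₂, ?_⟩
    have key := add_mem h₁ h₂
    rwa [show x - m₁ + (y - m₂) = x + y - (m₁ + m₂) by abel] at key
  | neg x _ ih =>
    obtain ⟨m, hm, h⟩ := ih
    refine ⟨-m, neg_mem hm, ?_⟩
    have key := neg_mem h
    rwa [show -(x - m) = -x - -m by abel] at key

/-- Transitivity of generator-wise congruences through an intermediate generating set. -/
theorem transfer_trans {S T U : Set KZ.FormalRep}
    (h₁ : ∀ x ∈ S, ∃ c ∈ AddSubgroup.closure T, x - c ∈ KZ.relations)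
    (h₂ : ∀ x ∈ T, ∃ c ∈ AddSubgroup.closure U, x - c ∈ KZ.relations) :
    ∀ x ∈ S, ∃ c ∈ AddSubgroup.closure U, x - c ∈ KZ.relations := by
  intro x hx
  obtain ⟨c, hc, hxc⟩ := h₁ x hx
  obtain ⟨d, hd, hcd⟩ := closure_transfer h₂ c hc
  refine ⟨d, hd, ?_⟩
  have key := add_mem hxc hcd
  rwa [sub_add_sub_cancel] at key

/-- `JJ b k ⊆ J b`. -/
theorem JJ_subset_J (b k : ℕ) : JJ b k ⊆ J b := by
  rintro w ⟨m, m', s, M, L, e, p, a, lo, hi, h⟩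
  exact ⟨k, m, m', s, M, L, e, p, a, lo, hi, h⟩

/-- `J b ⊆ ⋃ₖ JJ b k`. -/
theorem J_subset_iUnion (b : ℕ) : J b ⊆ ⋃ k, JJ b k := by
  rintro w ⟨k, m, m', s, M, L, e, p, a, lo, hi, h⟩
  exact Set.mem_iUnion.2 ⟨k, m, m', s, M, L, e, p, a, lo, hi, h⟩

/-- `GG b 2 k` is covered by its simple-pole part and its integrable part. -/
theorem GG_two_subset (b k : ℕ) : GG b 2 k ⊆ G₁ b k ∪ Gᵢ b k := by
  rintro w ⟨m, m', n₁, n₂, s, M, L, e, p, ℓ₁, ℓ₂, a, lo, hi, h12, hσ, hbd, hdom, hint, hw⟩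
  by_cases hn : n₂ = 1
  · exact Or.inl ⟨m, m', n₁, n₂, s, M, L, e, p, ℓ₁, ℓ₂, a, lo, hi, h12, hn,
      (hσ rfl).1, (hσ rfl).2, hbd, hdom, hint, hw⟩
  · exact Or.inr ⟨m, m', n₁, n₂, s, M, L, e, p, ℓ₁, ℓ₂, a, lo, hi, h12, hn,
      (hσ rfl).1, (hσ rfl).2, hbd, hdom, hint, hw⟩

/-- Rebase with NO fibre is vacuous: `GG b 1 0 ⊆ GG b 2 0` (the `σ = 2` clauses quantify over
`Fin 0`). -/
theorem GG_one_zero_subset (b : ℕ) : GG b 1 0 ⊆ GG b 2 0 := by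
  rintro w ⟨m, m', n₁, n₂, s, M, L, e, p, ℓ₁, ℓ₂, a, lo, hi, h12, -, hbd, hdom, hint, hw⟩
  exact ⟨m, m', n₁, n₂, s, M, L, e, p, ℓ₁, ℓ₂, a, lo, hi, h12,
    fun _ => ⟨fun i => Fin.elim0 i, fun i => Fin.elim0 i⟩, hbd, hdom, hint, hw⟩

/-- Separation in every base dimension, from the three registered parts. -/
theorem separate (b k : ℕ) :
    ∀ x ∈ JJ (b + 1) k, ∃ c ∈ AddSubgroup.closure (GG b 1 k), x - c ∈ KZ.relations := by
  rcases b with _ | _ | _ | b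
  · exact Summit.KontsevichZagierPeriods.ArrangementNormalForm.JanusBands.stub_separateZero JJ GG (fun _ _ => rfl) (fun _ _ _ => rfl) k
  · cases k with
    | zero => exact Summit.KontsevichZagierPeriods.ArrangementNormalForm.JanusBands.stub_separateTwoZero JJ GG (fun _ _ => rfl) (fun _ _ _ => rfl)
    | succ k => exact Summit.KontsevichZagierPeriods.ArrangementNormalForm.JanusBands.stub_separateTwoPos JJ GG (fun _ _ => rfl) (fun _ _ _ => rfl) Summit.KontsevichZagierPeriods.ArrangementNormalForm.JanusBands.stub_separateTwoPos_hI k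
  · cases k with
    | zero => exact Summit.KontsevichZagierPeriods.ArrangementNormalForm.JanusBands.stub_separateThreeZero JJ GG (fun _ _ => rfl) (fun _ _ _ => rfl)
    | succ k => exact Summit.KontsevichZagierPeriods.ArrangementNormalForm.JanusBands.separateHigh_threeFibres_of_hHk JJ GG (fun _ _ => rfl) (fun _ _ _ => rfl) Summit.KontsevichZagierPeriods.ArrangementNormalForm.JanusBands.separateThree_hHk k
  · exact Summit.KontsevichZagierPeriods.ArrangementNormalForm.JanusBands.separateHigh_of_hH JJ GG (fun _ _ => rfl) (fun _ _ _ => rfl) (b + 1) k (Summit.KontsevichZagierPeriods.ArrangementNormalForm.JanusBands.stub_separateHigh_hH b)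

/-- `GG b 1 k` is covered by its simple-pole part and its directly integrable part (v6). -/
theorem GG_one_subset (b k : ℕ) : GG b 1 k ⊆ GS b k ∪ GI b k := by
  rintro w ⟨m, m', n₁, n₂, s, M, L, e, p, ℓ₁, ℓ₂, a, lo, hi, h12, -, hbd, hdom, hint, hw⟩
  by_cases hn : n₂ = 1
  · exact Or.inl ⟨m, m', n₁, n₂, s, M, L, e, p, ℓ₁, ℓ₂, a, lo, hi, h12, hn, hbd, hdom, hint, hw⟩
  · exact Or.inr ⟨m, m', n₁, n₂, s, M, L, e, p, ℓ₁, ℓ₂, a, lo, hi, h12, hn, hbd, hdom, hint, hw⟩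

/-- `GS b k ⊆ GG b 1 k` (the `σ = 2` clause of `GG b 1 k` is vacuous). -/
theorem GS_subset_GG_one (b k : ℕ) : GS b k ⊆ GG b 1 k := by
  rintro w ⟨m, m', n₁, n₂, s, M, L, e, p, ℓ₁, ℓ₂, a, lo, hi, h12, -, hbd, hdom, hint, hw⟩
  exact ⟨m, m', n₁, n₂, s, M, L, e, p, ℓ₁, ℓ₂, a, lo, hi, h12, fun h => absurd h (by decide),
    hbd, hdom, hint, hw⟩

/-- Monotonicity of generator-wise congruences in the target set. -/
theorem transfer_mono {S T U : Set KZ.FormalRep} (hTU : T ⊆ U)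
    (h : ∀ x ∈ S, ∃ c ∈ AddSubgroup.closure T, x - c ∈ KZ.relations) :
    ∀ x ∈ S, ∃ c ∈ AddSubgroup.closure U, x - c ∈ KZ.relations := by
  intro x hx
  obtain ⟨c, hc, hxc⟩ := h x hx
  exact ⟨c, AddSubgroup.closure_mono hTU hc, hxc⟩

/-- Rebase of the simple-pole part in every base dimension and fibre number, from the registered parts
(`k = 0` vacuous, `(b, k) = (0, 1)` the landed `stub_rebaseOne`). v8: the target is widened to
`GG b 2 k ∪ JJ b (k + 1) ∪ JD (b + k)` — rebased, or already re-read, or of lower total dimension —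
which is exactly what the descent's induction hypotheses cover. -/
theorem rebase (b k : ℕ) :
    ∀ x ∈ GS b k, ∃ c ∈ AddSubgroup.closure (GG b 2 k ∪ JJ b (k + 1) ∪ JD (b + k)), x - c ∈ KZ.relations := by
  rcases k with _ | k
  · exact fun x hx => ⟨x, AddSubgroup.subset_closure (Or.inl (Or.inl (GG_one_zero_subset b (GS_subset_GG_one b 0 hx)))), by simp⟩
  · rcases b with _ | b
    · rcases k with _ | _ | k
      · exact transfer_mono (fun _ h => Or.inl (Or.inl h)) (fun x hx => Summit.KontsevichZagierPeriods.ArrangementNormalForm.JanusBands.stub_rebaseOne GG (fun _ _ _ => rfl) x (GS_subset_GG_one 0 1 hx))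
      · exact transfer_mono (fun _ h => Or.inl (Or.inl h)) (stub_rebaseSimpleZeroTwo GS GG (fun _ _ => rfl) (fun _ _ _ => rfl))
      · simpa only [show k + 1 + 1 + 1 = k + 3 by omega, show k + 1 + 1 + 1 + 1 = k + 4 by omega,
          show 0 + (k + 1 + 1 + 1) = k + 3 by omega] using
          stub_rebaseSimpleZeroMany GS GG (fun _ _ => rfl) (fun _ _ _ => rfl) JJ JD (fun _ _ => rfl) (fun _ => rfl) k
    · rcases k with _ | k
      · rcases b with _ | _ | b
        · exact transfer_mono (fun _ h => Or.inl (Or.inl h)) (Summit.KontsevichZagierPeriods.ArrangementNormalForm.JanusBands.stub_rebaseSimplePosOneZero GS GG (fun _ _ => rfl) (fun _ _ _ => rfl))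
        · exact Summit.KontsevichZagierPeriods.ArrangementNormalForm.JanusBands.rebaseSimplePosOnePos_two' GS GG (fun _ _ => rfl) (fun _ _ _ => rfl) JJ JD (fun _ _ => rfl) (fun _ => rfl)
        · show ∀ x ∈ GS (b + 3) 1, ∃ c ∈ AddSubgroup.closure (GG (b + 3) 2 1 ∪ JJ (b + 3) 2 ∪ JD (b + 4)), x - c ∈ KZ.relations
          exact transfer_mono (fun _ h => Or.inl (Or.inl h)) (stub_rebaseSimplePosOneHigh GS GG (fun _ _ => rfl) (fun _ _ _ => rfl) b)
      · simpa only [show b + k + 3 = b + 1 + (k + 2) by omega] using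
          stub_rebaseSimplePosMany GS GG (fun _ _ => rfl) (fun _ _ _ => rfl) JJ JD (fun _ _ => rfl) (fun _ => rfl) b k

/-- The endgame on `JJ 0 k`: unletter (landed) then words (landed). -/
theorem endgame (k : ℕ) :
    ∀ x ∈ JJ 0 k, ∃ c ∈ AddSubgroup.closure wordGens, x - c ∈ KZ.relations :=
  fun x hx => transfer_trans (Summit.KontsevichZagierPeriods.ArrangementNormalForm.JanusBands.stub_unletter J Jw (fun _ => rfl) rfl)
    (Summit.KontsevichZagierPeriods.ArrangementNormalForm.JanusBands.stub_words Jw rfl) x (JJ_subset_J 0 k hx)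

/-- **Descent.** Every Janus band representation is congruent to a `ℤ`-combination of words:
lexicographic induction on (total dimension `b + k`, base dimension `b`). -/
theorem descend : ∀ N b k : ℕ, b + k = N →
    ∀ x ∈ JJ b k, ∃ c ∈ AddSubgroup.closure wordGens, x - c ∈ KZ.relations := by
  intro N
  induction N using Nat.strong_induction_on with
  | _ N ihN =>
  intro b
  induction b with
  | zero => intro k _; exact endgame k
  | succ b ihb =>
    intro k hN
    have hround : ∀ x ∈ GG b 2 k, ∃ c ∈ AddSubgroup.closure wordGens, x - c ∈ KZ.relations := by
      intro x hx
      rcases GG_two_subset b k hx with h | h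
      · exact transfer_trans (Summit.KontsevichZagierPeriods.ArrangementNormalForm.JanusBands.stub_reRead JJ G₁ (fun _ _ => rfl) (fun _ _ => rfl) b k)
          (ihb (k + 1) (by omega)) x h
      · refine transfer_trans
          (Summit.KontsevichZagierPeriods.ArrangementNormalForm.JanusBands.stub_integrateOut JJ Gᵢ JD (fun _ _ => rfl) (fun _ _ => rfl) (fun _ => rfl) b k)
          ?_ x h
        rintro w ⟨b', k', hbk, hw⟩
        exact ihN (b + k) (by omega) b' k' hbk w hw
    have hJD : ∀ x ∈ JD (b + k), ∃ c ∈ AddSubgroup.closure wordGens, x - c ∈ KZ.relations := by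
      rintro w ⟨b', k', hbk, hw⟩
      exact ihN (b + k) (by omega) b' k' hbk w hw
    have hunion : ∀ x ∈ GG b 2 k ∪ JJ b (k + 1) ∪ JD (b + k),
        ∃ c ∈ AddSubgroup.closure wordGens, x - c ∈ KZ.relations := by
      rintro x ((h | h) | h)
      · exact hround x h
      · exact ihb (k + 1) (by omega) x h
      · exact hJD x h
    have hone : ∀ x ∈ GG b 1 k, ∃ c ∈ AddSubgroup.closure wordGens, x - c ∈ KZ.relations := by
      intro x hx
      rcases GG_one_subset b k hx with h | h
      · exact transfer_trans (rebase b k) hunion x h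
      · exact transfer_trans
          (Summit.KontsevichZagierPeriods.ArrangementNormalForm.JanusBands.stub_integrateOutPrime JJ GI JD (fun _ _ => rfl) (fun _ _ => rfl) (fun _ => rfl) b k) hJD x h
    exact transfer_trans (separate b k) hone

/-- Separation for base dimension `b + 1 ≤ 2` needs only the landed `stub_separateZero` and
`stub_separateTwoZero` when there is no fibre in base dimension `2`. -/
theorem separate_le_two (b k : ℕ) (h : b + 1 + k ≤ 2) :
    ∀ x ∈ JJ (b + 1) k, ∃ c ∈ AddSubgroup.closure (GG b 1 k), x - c ∈ KZ.relations := by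
  rcases b with _ | _ | b
  · exact Summit.KontsevichZagierPeriods.ArrangementNormalForm.JanusBands.stub_separateZero JJ GG (fun _ _ => rfl) (fun _ _ _ => rfl) k
  · obtain rfl : k = 0 := by omega
    exact Summit.KontsevichZagierPeriods.ArrangementNormalForm.JanusBands.stub_separateTwoZero JJ GG (fun _ _ => rfl) (fun _ _ _ => rfl)
  · omega

/-- Rebase for `b + 1 + k ≤ 2` needs only `k = 0` (vacuous) and the landed `stub_rebaseOne`. -/
theorem rebase_le_two (b k : ℕ) (h : b + 1 + k ≤ 2) :
    ∀ x ∈ GG b 1 k, ∃ c ∈ AddSubgroup.closure (GG b 2 k), x - c ∈ KZ.relations := by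
  rcases k with _ | _ | k
  · exact fun x hx => ⟨x, AddSubgroup.subset_closure (GG_one_zero_subset b hx), by simp⟩
  · obtain rfl : b = 0 := by omega
    exact Summit.KontsevichZagierPeriods.ArrangementNormalForm.JanusBands.stub_rebaseOne GG (fun _ _ _ => rfl)
  · omega

/-- **Planar descent.** Inside total dimension `≤ 2` the descent uses only LANDED stubs and
`stub_separateTwoZero`: total dimension never increases along a round (`reRead` keeps it,
`integrateOut` lowers it), so no fibre ever meets a base of dimension `2`. -/
theorem descend_le_two : ∀ N, N ≤ 2 → ∀ b k : ℕ, b + k = N →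
    ∀ x ∈ JJ b k, ∃ c ∈ AddSubgroup.closure wordGens, x - c ∈ KZ.relations := by
  intro N
  induction N using Nat.strong_induction_on with
  | _ N ihN =>
  intro hN2 b
  induction b with
  | zero => intro k _; exact endgame k
  | succ b ihb =>
    intro k hN
    have hround : ∀ x ∈ GG b 2 k, ∃ c ∈ AddSubgroup.closure wordGens, x - c ∈ KZ.relations := by
      intro x hx
      rcases GG_two_subset b k hx with h | h
      · exact transfer_trans (Summit.KontsevichZagierPeriods.ArrangementNormalForm.JanusBands.stub_reRead JJ G₁ (fun _ _ => rfl) (fun _ _ => rfl) b k)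
          (ihb (k + 1) (by omega)) x h
      · refine transfer_trans
          (Summit.KontsevichZagierPeriods.ArrangementNormalForm.JanusBands.stub_integrateOut JJ Gᵢ JD (fun _ _ => rfl) (fun _ _ => rfl) (fun _ => rfl) b k)
          ?_ x h
        rintro w ⟨b', k', hbk, hw⟩
        exact ihN (b + k) (by omega) (by omega) b' k' hbk w hw
    exact transfer_trans (separate_le_two b k (by omega))
      (transfer_trans (rebase_le_two b k (by omega)) hround)

/-- Separation for base dimension `b + 1 ≤ 3`: the landed `stub_separateZero`, `stub_separateTwoZero`,
`stub_separateTwoPos` (given `stub_separateTwoPos_hI`) and `stub_separateThreeZero`. -/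
theorem separate_le_three (b k : ℕ) (h : b + 1 + k ≤ 3) :
    ∀ x ∈ JJ (b + 1) k, ∃ c ∈ AddSubgroup.closure (GG b 1 k), x - c ∈ KZ.relations := by
  rcases b with _ | _ | _ | b
  · exact Summit.KontsevichZagierPeriods.ArrangementNormalForm.JanusBands.stub_separateZero JJ GG (fun _ _ => rfl) (fun _ _ _ => rfl) k
  · rcases k with _ | _ | k
    · exact Summit.KontsevichZagierPeriods.ArrangementNormalForm.JanusBands.stub_separateTwoZero JJ GG (fun _ _ => rfl) (fun _ _ _ => rfl)
    · exact Summit.KontsevichZagierPeriods.ArrangementNormalForm.JanusBands.stub_separateTwoPos JJ GG (fun _ _ => rfl) (fun _ _ _ => rfl) Summit.KontsevichZagierPeriods.ArrangementNormalForm.JanusBands.stub_separateTwoPos_hI 0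
    · omega
  · obtain rfl : k = 0 := by omega
    exact Summit.KontsevichZagierPeriods.ArrangementNormalForm.JanusBands.stub_separateThreeZero JJ GG (fun _ _ => rfl) (fun _ _ _ => rfl)
  · omega

/-- Rebase for `b + 1 + k ≤ 3`: `k = 0` (vacuous), the landed `stub_rebaseOne`, `stub_rebaseSimpleZeroTwo`
and `stub_rebaseSimplePosOneZero`. -/
theorem rebase_le_three (b k : ℕ) (h : b + 1 + k ≤ 3) :
    ∀ x ∈ GS b k, ∃ c ∈ AddSubgroup.closure (GG b 2 k ∪ JJ b (k + 1) ∪ JD (b + k)), x - c ∈ KZ.relations := by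
  rcases k with _ | _ | _ | k
  · exact fun x hx => ⟨x, AddSubgroup.subset_closure (Or.inl (Or.inl (GG_one_zero_subset b (GS_subset_GG_one b 0 hx)))), by simp⟩
  · rcases b with _ | _ | b
    · exact transfer_mono (fun _ h => Or.inl (Or.inl h)) (fun x hx => Summit.KontsevichZagierPeriods.ArrangementNormalForm.JanusBands.stub_rebaseOne GG (fun _ _ _ => rfl) x (GS_subset_GG_one 0 1 hx))
    · exact transfer_mono (fun _ h => Or.inl (Or.inl h)) (Summit.KontsevichZagierPeriods.ArrangementNormalForm.JanusBands.stub_rebaseSimplePosOneZero GS GG (fun _ _ => rfl) (fun _ _ _ => rfl))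
    · omega
  · obtain rfl : b = 0 := by omega
    exact transfer_mono (fun _ h => Or.inl (Or.inl h)) (stub_rebaseSimpleZeroTwo GS GG (fun _ _ => rfl) (fun _ _ _ => rfl))
  · omega

/-- **Descent in total dimension `≤ 3`.** Uses, besides the landed stubs, exactly the four minimal open
cases `stub_separateTwoPos_hI`, `stub_separateThreeZero`, `stub_rebaseSimpleZeroTwo`,
`stub_rebaseSimplePosOne` (total dimension never increases along a round). -/
theorem descend_le_three : ∀ N, N ≤ 3 → ∀ b k : ℕ, b + k = N →
    ∀ x ∈ JJ b k, ∃ c ∈ AddSubgroup.closure wordGens, x - c ∈ KZ.relations := by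
  intro N
  induction N using Nat.strong_induction_on with
  | _ N ihN =>
  intro hN3 b
  induction b with
  | zero => intro k _; exact endgame k
  | succ b ihb =>
    intro k hN
    have hround : ∀ x ∈ GG b 2 k, ∃ c ∈ AddSubgroup.closure wordGens, x - c ∈ KZ.relations := by
      intro x hx
      rcases GG_two_subset b k hx with h | h
      · exact transfer_trans (Summit.KontsevichZagierPeriods.ArrangementNormalForm.JanusBands.stub_reRead JJ G₁ (fun _ _ => rfl) (fun _ _ => rfl) b k)
          (ihb (k + 1) (by omega)) x h
      · refine transfer_trans
          (Summit.KontsevichZagierPeriods.ArrangementNormalForm.JanusBands.stub_integrateOut JJ Gᵢ JD (fun _ _ => rfl) (fun _ _ => rfl) (fun _ => rfl) b k)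
          ?_ x h
        rintro w ⟨b', k', hbk, hw⟩
        exact ihN (b + k) (by omega) (by omega) b' k' hbk w hw
    have hJD : ∀ x ∈ JD (b + k), ∃ c ∈ AddSubgroup.closure wordGens, x - c ∈ KZ.relations := by
      rintro w ⟨b', k', hbk, hw⟩
      exact ihN (b + k) (by omega) (by omega) b' k' hbk w hw
    have hunion : ∀ x ∈ GG b 2 k ∪ JJ b (k + 1) ∪ JD (b + k),
        ∃ c ∈ AddSubgroup.closure wordGens, x - c ∈ KZ.relations := by
      rintro x ((h | h) | h)
      · exact hround x h
      · exact ihb (k + 1) (by omega) x h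
      · exact hJD x h
    have hone : ∀ x ∈ GG b 1 k, ∃ c ∈ AddSubgroup.closure wordGens, x - c ∈ KZ.relations := by
      intro x hx
      rcases GG_one_subset b k hx with h | h
      · exact transfer_trans (rebase_le_three b k (by omega)) hunion x h
      · exact transfer_trans
          (Summit.KontsevichZagierPeriods.ArrangementNormalForm.JanusBands.stub_integrateOutPrime JJ GI JD (fun _ _ => rfl) (fun _ _ => rfl) (fun _ => rfl) b k) hJD x h
    exact transfer_trans (separate_le_three b k (by omega)) hone

/-- **The crux in dimension `≤ 3` (spatial arrangement normal form), from the four minimal open cases.**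
Every absolutely convergent representation `[open rational polyhedron (possibly unbounded), p/∏Lⱼ^{eⱼ}]`,
`n ≤ 3`, is congruent modulo `KZ.relations` to a `ℤ`-combination of hyperlogarithm word representations
(of weight `≤ 3`), given `stub_separateTwoPos_hI`, `stub_separateThreeZero`, `stub_rebaseSimpleZeroTwo`
and `stub_rebaseSimplePosOne` (and none of the three general remainders). -/
theorem ArrangementNormalForm_dimLE3 (n m m' : ℕ) (r : KZ.IntegralRep n) (M : Fin m' → (Fin n → ℚ) × ℚ) (L : Fin m → (Fin n → ℚ) × ℚ) (e : Fin m → ℕ) (p : MvPolynomial (Fin n) ℚ) (hdom : r.domain = {x | ∀ j, 0 < ∑ i, ((M j).1 i : ℝ) * x i + ((M j).2 : ℝ)}) (hint : EqOn r.integrand (fun x => MvPolynomial.aeval x p / ∏ j, (∑ i, ((L j).1 i : ℝ) * x i + ((L j).2 : ℝ)) ^ e j) r.domain) (hn : n ≤ 3) :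
    ∃ c ∈ AddSubgroup.closure wordGens, KZ.of r - c ∈ KZ.relations := by
  obtain ⟨c, hc, hrc⟩ := Summit.KontsevichZagierPeriods.ArrangementNormalForm.JanusBands.stub_compactifyZero JJ (fun _ _ => rfl) n m m' r M L e p hdom hint
  obtain ⟨d, hd, hcd⟩ := closure_transfer (descend_le_three n hn n 0 rfl) c hc
  refine ⟨d, hd, ?_⟩
  have key := add_mem hrc hcd
  rwa [sub_add_sub_cancel] at key

/-- **The crux in dimension `≤ 2` (planar arrangement normal form).** Every absolutely convergent
representation `[open rational polygon or interval (possibly unbounded), p/∏Lⱼ^{eⱼ}]`, `n ≤ 2`,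
is congruent modulo `KZ.relations` to a `ℤ`-combination of hyperlogarithm word representations
(necessarily of weight `≤ 2`: dilogarithm / log·log / log / rational words) — from the landed
stubs plus `stub_compactifyZero` and `stub_separateTwoZero` only. -/
theorem ArrangementNormalForm_dimLE2 (n m m' : ℕ) (r : KZ.IntegralRep n) (M : Fin m' → (Fin n → ℚ) × ℚ) (L : Fin m → (Fin n → ℚ) × ℚ) (e : Fin m → ℕ) (p : MvPolynomial (Fin n) ℚ) (hdom : r.domain = {x | ∀ j, 0 < ∑ i, ((M j).1 i : ℝ) * x i + ((M j).2 : ℝ)}) (hint : EqOn r.integrand (fun x => MvPolynomial.aeval x p / ∏ j, (∑ i, ((L j).1 i : ℝ) * x i + ((L j).2 : ℝ)) ^ e j) r.domain) (hn : n ≤ 2) :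
    ∃ c ∈ AddSubgroup.closure wordGens, KZ.of r - c ∈ KZ.relations := by
  obtain ⟨c, hc, hrc⟩ := Summit.KontsevichZagierPeriods.ArrangementNormalForm.JanusBands.stub_compactifyZero JJ (fun _ _ => rfl) n m m' r M L e p hdom hint
  obtain ⟨d, hd, hcd⟩ := closure_transfer (descend_le_two n hn n 0 rfl) c hc
  refine ⟨d, hd, ?_⟩
  have key := add_mem hrc hcd
  rwa [sub_add_sub_cancel] at key

/-- **The crux, from the stubs.** `LinRedNormalForm.ArrangementNormalForm` BY NAME: compactify
(landed) into `closure (J n)`, and descend. -/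
theorem ArrangementNormalForm_of :
    Summit.KontsevichZagierPeriods.KontsevichZagierPeriods.Theses.LinRedNormalForm.ArrangementNormalForm := by
  intro n m m' r M L e p hdom hint
  obtain ⟨c, hc, hrc⟩ :=
    Summit.KontsevichZagierPeriods.ArrangementNormalForm.JanusBands.stub_compactify J (fun _ => rfl) n m m' r M L e p hdom hint
  have hJn : ∀ x ∈ J n, ∃ d ∈ AddSubgroup.closure wordGens, x - d ∈ KZ.relations := by
    intro x hx
    obtain ⟨k, hk⟩ := Set.mem_iUnion.1 (J_subset_iUnion n hx)
    exact descend (n + k) n k rfl x hk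
  obtain ⟨d, hd, hcd⟩ := closure_transfer hJn c hc
  refine ⟨d, hd, ?_⟩
  have key := add_mem hrc hcd
  rwa [sub_add_sub_cancel] at key

end Summit.KontsevichZagierPeriods.KontsevichZagierPeriods.Cruxes.ArrangementNormalForm.JanusBands
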